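import Literature.Analysis.OperatorTheory.RieszProjectionContour
import Mathlib.Topology.UniformSpace.HeineCantor
import HarnessLib

/-!
# Perturbation of the Riesz projection: upper semicontinuity of the spectrum and persistence of
  a separated part (Kato IV-§3.1, §3.4 Thm. 3.16, bounded case)

Analysis/OperatorTheory proofs-layer file (theorems only, no definitions, no named facts),
continuing `RieszProjectionContour.lean` (see also `RieszProjectionIdempotent.lean`). For elements of a
complex Banach algebra `A` (bounded operators), perturbed in NORM:

* `isOpen_setOf_mem_resolventSet`, `continuousOn_resolvent_uncurry`: the resolvent
  `(b, z) ↦ (z − b)⁻¹` is defined on an open subset of `A × ℂ` and jointly continuous there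
  (Kato IV-§3.3, Thm. 3.15, bounded case; Mathlib: the units form an open set on which
  `Ring.inverse` is continuous);
* `eventually_subset_resolventSet`: **upper semicontinuity of the spectrum** — a compact subset
  of `ρ(a)` lies in `ρ(b)` for all `b` near `a` (Kato IV-§3.1, Thm. 3.1 and Remark 3.2:
  "`Γ ⊂ P(S)` if `‖A‖ < min_Γ ‖R(ζ)‖⁻¹`");
* `tendstoUniformlyOn_resolvent`: `R(ζ, b) → R(ζ, a)` uniformly on compact subsets of `ρ(a)`
  ("`‖R(ζ,S) − R(ζ,T)‖` is small uniformly for `ζ ∈ Γ`", proof of Kato IV Thm. 3.16);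
* `tendsto_circleIntegral_resolvent`, `continuousAt_rieszProjection`: **`P[b] → P[a]` in norm**
  (Kato IV-§3.4, Thm. 3.16 with (3.11); the passage under the integral sign is Mathlib's
  `TendstoUniformlyOn.tendsto_circleIntegral_of_continuousOn`);
* `eventually_rieszProjection_ne_zero`, `eventually_spectrum_inter_ball_nonempty`,
  `eventually_spectrum_inter_ball_nonempty_of_apply_eq_smul`: **persistence of a separated part
  of the spectrum** — if `P[a] ≠ 0` (e.g. `a` has an eigenvalue inside the circle), then every
  `b` near `a` has spectrum in the open disc (Kato IV Thm. 3.16: "both `Σ′(S)` and `Σ″(S)` are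
  nonempty if this is true for `T`"). This is the norm-perturbation (bounded) prototype of the
  argument "the spectral projection converges, hence is non-trivial, hence there is an unstable
  eigenvalue" of Albritton–Brué–Colombo 2022 (Prop. 2.2, Prop. 2.6, Thm. 3.1), where the
  convergence is only strong and the operators are unbounded.

Not here: the isomorphism `M′(S) ≅ M′(T)` / `dim M′(S) = dim M′(T)` of Thm. 3.16 (Kato I-§4.6,
pairs of projections).

## References

* T. Kato, *Perturbation Theory for Linear Operators*, Springer 1966, IV-§3.1 Thm. 3.1 and
  Remark 3.2 (chunk p0255 of the held copy), IV-§3.3 Thm. 3.15, IV-§3.4 Thm. 3.16 and (3.11)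
  (chunk p0260). [Kato1966]
* D. Albritton, E. Brué, M. Colombo, arXiv:2112.03116, end of the proofs of Prop. 2.6 and
  Thm. 3.1. [AlbrittonBrueColombo2022AnnMath]
-/

noncomputable section

open Complex MeasureTheory Metric Set Filter Topology

namespace Literature.Analysis.OperatorTheory

section BanachAlgebra

variable {A : Type*} [NormedRing A] [NormedAlgebra ℂ A] [CompleteSpace A]

/-! ### Joint openness and continuity of the resolvent -/

/-- The pairs `(b, z)` with `z ∈ ρ(b)` form an open subset of `A × ℂ` (the units of a Banach
algebra are open; Kato IV-§3.1). [cite: Kato1966, IV-§3.1 Thm. 3.1 and Remark 3.2] -/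
theorem isOpen_setOf_mem_resolventSet : IsOpen {p : A × ℂ | p.2 ∈ resolventSet ℂ p.1} := by
  have hcont : Continuous fun p : A × ℂ => algebraMap ℂ A p.2 - p.1 :=
    ((continuous_algebraMap ℂ A).comp continuous_snd).sub continuous_fst
  exact Units.isOpen.preimage hcont

/-- **The resolvent `(b, z) ↦ (z − b)⁻¹` is jointly continuous** on `{(b, z) | z ∈ ρ(b)}`
(Kato IV-§3.3, Thm. 3.15, bounded case: `R(ζ, T)` is continuous in `ζ` and `T` jointly).
[cite: Kato1966, IV-§3.3 Thm. 3.15] -/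
theorem continuousOn_resolvent_uncurry :
    ContinuousOn (fun p : A × ℂ => resolvent p.1 p.2) {p : A × ℂ | p.2 ∈ resolventSet ℂ p.1} := by
  intro p hp
  have hcont : Continuous fun p : A × ℂ => algebraMap ℂ A p.2 - p.1 :=
    ((continuous_algebraMap ℂ A).comp continuous_snd).sub continuous_fst
  have hu : IsUnit (algebraMap ℂ A p.2 - p.1) := hp
  have h1 : ContinuousAt Ring.inverse (algebraMap ℂ A p.2 - p.1) := by
    obtain ⟨u, hu'⟩ := hu
    rw [← hu']
    exact NormedRing.inverse_continuousAt u
  have heq : (fun p : A × ℂ => resolvent p.1 p.2) =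
      Ring.inverse ∘ fun p : A × ℂ => algebraMap ℂ A p.2 - p.1 := rfl
  rw [heq]
  exact (ContinuousAt.comp (f := fun p : A × ℂ => algebraMap ℂ A p.2 - p.1) h1
    hcont.continuousAt).continuousWithinAt

/-! ### Upper semicontinuity of the spectrum -/

/-- **Upper semicontinuity of the spectrum** (Kato IV-§3.1, Thm. 3.1 / Remark 3.2): a compact
subset `K` of the resolvent set of `a` lies in the resolvent set of every `b` sufficiently close
to `a` in norm; equivalently `σ(b) ∩ K = ∅` for `b` near `a`. [cite: Kato1966, IV-§3.1 Thm. 3.1 and Remark 3.2] -/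
theorem eventually_subset_resolventSet {a : A} {K : Set ℂ} (hK : IsCompact K)
    (h : K ⊆ resolventSet ℂ a) : ∀ᶠ b in 𝓝 a, K ⊆ resolventSet ℂ b := by
  obtain ⟨u, v, hu, -, hau, hKv, huv⟩ := generalized_tube_lemma isCompact_singleton hK
    isOpen_setOf_mem_resolventSet (fun p hp => by
      obtain ⟨h1, h2⟩ := hp
      rw [mem_singleton_iff] at h1
      simp only [mem_setOf_eq, h1]
      exact h h2)
  filter_upwards [hu.mem_nhds (hau (mem_singleton a))] with b hb z hz
  exact huv (mk_mem_prod hb (hKv hz))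

/-- In particular a closed disc in `ρ(a)` stays in `ρ(b)` for `b` near `a`: the spectrum cannot
suddenly enter it ("`Σ(T)` does not expand suddenly", Kato IV-§3.2). [cite: Kato1966, IV-§3.1 Thm. 3.1 and Remark 3.2] -/
theorem eventually_closedBall_subset_resolventSet {a : A} {c : ℂ} {R : ℝ}
    (h : closedBall c R ⊆ resolventSet ℂ a) : ∀ᶠ b in 𝓝 a, closedBall c R ⊆ resolventSet ℂ b :=
  eventually_subset_resolventSet (isCompact_closedBall c R) h

/-! ### Uniform convergence of resolvents and continuity of the Riesz projection -/

/-- **Resolvents converge uniformly on compact subsets of the resolvent set**: if `b → a` in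
norm then `(z − b)⁻¹ → (z − a)⁻¹` uniformly for `z` in a compact `K ⊆ ρ(a)` (proof of Kato IV
Thm. 3.16: "`‖R(ζ,S) − R(ζ,T)‖` is small uniformly for `ζ ∈ Γ` if `δ(S,T)` is sufficiently
small"; here from joint continuity and compactness). [cite: Kato1966, IV-§3.4 Thm. 3.16 (proof)] -/
theorem tendstoUniformlyOn_resolvent {a : A} {K : Set ℂ} (hK : IsCompact K)
    (h : K ⊆ resolventSet ℂ a) :
    TendstoUniformlyOn (fun b : A => resolvent b) (resolvent a) (𝓝 a) K := by
  obtain ⟨u, v, hu, -, hau, hKv, huv⟩ := generalized_tube_lemma isCompact_singleton hK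
    isOpen_setOf_mem_resolventSet (fun p hp => by
      obtain ⟨h1, h2⟩ := hp
      rw [mem_singleton_iff] at h1
      simp only [mem_setOf_eq, h1]
      exact h h2)
  have hau' : a ∈ u := hau (mem_singleton a)
  have hcont : ContinuousOn (Function.uncurry fun (b : A) (z : ℂ) => resolvent b z) (u ×ˢ K) :=
    continuousOn_resolvent_uncurry.mono fun p hp => huv ⟨hp.1, hKv hp.2⟩
  rw [Metric.tendstoUniformlyOn_iff]
  intro ε hε
  obtain ⟨w, hw, hwK⟩ := hK.mem_uniformity_of_prod hcont hau' (Metric.dist_mem_uniformity hε)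
  have hw' : w ∈ 𝓝 a := by rwa [nhdsWithin_eq_nhds.2 (hu.mem_nhds hau')] at hw
  filter_upwards [hw'] with b hb z hz
  rw [dist_comm]
  exact hwK b hb z hz

/-- **The Riesz integral depends continuously on the operator** (Kato IV-§3.4, Thm. 3.16 with
(3.11)): if the circle `|z − c| = R` lies in `ρ(a)`, then
`∮_{C(c,R)} (z − b)⁻¹ dz → ∮_{C(c,R)} (z − a)⁻¹ dz` as `b → a` in norm.
[cite: Kato1966, IV-§3.4 Thm. 3.16 (3.11)] -/
theorem tendsto_circleIntegral_resolvent {a : A} {c : ℂ} {R : ℝ} (hR : 0 ≤ R)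
    (hs : sphere c R ⊆ resolventSet ℂ a) :
    Tendsto (fun b : A => ∮ z in C(c, R), resolvent b z) (𝓝 a)
      (𝓝 (∮ z in C(c, R), resolvent a z)) :=
  TendstoUniformlyOn.tendsto_circleIntegral_of_continuousOn hR
    ((eventually_subset_resolventSet (isCompact_sphere c R) hs).mono fun b hb =>
      (continuousOn_resolvent b).mono hb)
    (tendstoUniformlyOn_resolvent (isCompact_sphere c R) hs)

/-- **`P[b] → P[a]` in norm** as `b → a` (Kato IV-§3.4, Thm. 3.16: "the projection `P[S]` …
tends to `P[T]` in norm as `δ(S, T) → 0`", bounded case). [cite: Kato1966, IV-§3.4 Thm. 3.16] -/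
theorem continuousAt_rieszProjection {a : A} {c : ℂ} {R : ℝ} (hR : 0 ≤ R)
    (hs : sphere c R ⊆ resolventSet ℂ a) :
    ContinuousAt (fun b : A => rieszProjection b c R) a := by
  change Tendsto (fun b : A => rieszProjection b c R) (𝓝 a) (𝓝 (rieszProjection a c R))
  simp only [rieszProjection_def]
  exact (tendsto_circleIntegral_resolvent hR hs).const_smul _

/-! ### Persistence of a separated part of the spectrum -/

/-- If the Riesz projection of `a` over a circle in `ρ(a)` is non-zero, so is that of every `b`
near `a` (Kato IV Thm. 3.16: "both `Σ′(S)` and `Σ″(S)` are nonempty if this is true for `T`").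
[cite: Kato1966, IV-§3.4 Thm. 3.16] -/
theorem eventually_rieszProjection_ne_zero {a : A} {c : ℂ} {R : ℝ} (hR : 0 ≤ R)
    (hs : sphere c R ⊆ resolventSet ℂ a) (hne : rieszProjection a c R ≠ 0) :
    ∀ᶠ b in 𝓝 a, rieszProjection b c R ≠ 0 :=
  (continuousAt_rieszProjection hR hs).eventually_ne hne

/-- **Persistence of spectrum inside the circle under small norm perturbations**: if the circle
lies in `ρ(a)` and `P[a] ≠ 0`, then every `b` sufficiently close to `a` has spectrum in the open
disc `|z − c| < R` (Kato IV-§3.4 Thm. 3.16, lower semicontinuity of a separated part; combined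
with `spectrum_inter_ball_nonempty_of_rieszProjection_ne_zero`). [cite: Kato1966, IV-§3.4 Thm. 3.16] -/
theorem eventually_spectrum_inter_ball_nonempty {a : A} {c : ℂ} {R : ℝ} (hR : 0 ≤ R)
    (hs : sphere c R ⊆ resolventSet ℂ a) (hne : rieszProjection a c R ≠ 0) :
    ∀ᶠ b in 𝓝 a, (spectrum ℂ b ∩ ball c R).Nonempty := by
  filter_upwards [eventually_rieszProjection_ne_zero hR hs hne,
    eventually_subset_resolventSet (isCompact_sphere c R) hs] with b hb hsb
  exact spectrum_inter_ball_nonempty_of_rieszProjection_ne_zero hR hsb hb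

end BanachAlgebra

section Operator

variable {E : Type*} [NormedAddCommGroup E] [NormedSpace ℂ E] [CompleteSpace E]

/-- **An eigenvalue inside the circle survives small norm perturbations as spectrum inside the
circle**: if `T v = μ v`, `v ≠ 0`, `|μ − c| < R` and the circle `|z − c| = R` lies in `ρ(T)`, then
every bounded operator `S` sufficiently close to `T` in norm has spectrum in the open disc
(Kato IV-§3.4 Thm. 3.16 / §3.5; the norm-perturbation prototype of the conclusion of
Albritton–Brué–Colombo 2022, Prop. 2.6 and Thm. 3.1). [cite: Kato1966, IV-§3.4 Thm. 3.16] -/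
theorem eventually_spectrum_inter_ball_nonempty_of_apply_eq_smul {T : E →L[ℂ] E} {μ : ℂ} {v : E}
    (hv : T v = μ • v) (hv0 : v ≠ 0) {c : ℂ} {R : ℝ} (hμ : μ ∈ ball c R)
    (hs : sphere c R ⊆ resolventSet ℂ T) :
    ∀ᶠ S in 𝓝 T, (spectrum ℂ S ∩ ball c R).Nonempty :=
  eventually_spectrum_inter_ball_nonempty (dist_nonneg.trans (mem_ball.1 hμ).le) hs
    (rieszProjection_ne_zero_of_apply_eq_smul hv hv0 hμ hs)

end Operator

end Literature.Analysis.OperatorTheory
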